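/-
Copyright (c) 2026 the pub-hodgecm-mathlib formalisation cell (harness21).  Prover seat hodgecm-mathlib-K2Liu-p10 (g2), Track B «K2-LIT»,
#184♮ = hLiu418 = `stmt-HodgeConjecture-24832`; LEAD F0P6-plan (g12) RULING «M-156n» (1) 2026-09-04T08:09:40Z «Φ9-CORE = GO NOW», ROAD Φ's END; file 2∕2
(the instance at socket #41's currency).  THEOREMS ONLY (no `def`, no `instance`, no named-fact hypothesis, no `sorry`); NO `Lines` import — the typist ties.
-/
import Summits.HodgeConjecture.HodgeConjecture.Theorems.K2LiuSiegelEisensteinAssemblyCore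
import Summits.HodgeConjecture.HodgeConjecture.Theorems.K2LiuSiegelEisensteinDoubledLeftInvariant
import Literature.NumberTheory.Automorphic.AdelicGLnGlue
import HarnessLib

/-!
# Crux `HLiu418`, ROAD Φ, organ Φ9 (the instance): from TERM PACKAGES of the Fourier expansion of `(∏_{p∈P}(s−p))·E^Δ(h; f_s)` and ONE locally uniform
# summable majorant with summed growth `≤ C·‖h‖^A`, the five clauses of socket #41 `sig_K2LiuSiegelEisensteinContinuation` — VERBATIM

Cell `hodgecm-mathlib`, crux item hLiu418 = `stmt-HodgeConjecture-24832` (helper lane, count-neutral).  ★ `K2LiuSiegelEisensteinAssemblyCore.exists_package_of_term_packages`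
at `X := H(𝔸) = HA`, `height h := adelicHeightGL (n+n) L ↑h`, symmetries `σ γ h := ↑γ * h` (`γ ∈ H(L⁺) = ratH`), `E := eisensteinFamilyDelta L e dV hdV dW hdW f`, `a := 0`,
`c := n∕2`; the symmetry input (A3) on the convergence half-plane is DISCHARGED by ★ #10b `K2LiuSiegelEisensteinDoubledLeftInvariant.siegelEisensteinDoubledLeftInvariant`
from `hf : ∀ s, IsSiegelDeltaSection χ s (f s)` (every standard family is one).  What the organs of Road Φ must deliver (consumer sheet
`K2/K2Liu-p10/g2/CENSUS-Phi9-Assembly.K2Liu-p10-g2.md`, RULING M-156n (2)): the index type `ι` (Φ1's `skewMatrices …`, possibly refined by cells), the TERM PACKAGES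
`Ec i` with `hd`∕`hc` (Φ2∕Φ3∕Φ4∕Φ5∕Φ6b∕Φ7∕Φ8), the EXPANSION `heq` (★ Φ1 `hasSum_fourierCoeffDelta` of the pole-cleared series, its `hsum` being the majorant), the
MAJORANT `hmaj` (Φ4 × Φ5 × Φ6b bookkeeping) and the SUMMED GROWTH `hgrowth` (G7, Iwasawa-vs-height).  OUTPUT = the `∃ (P) (Es), (A1) ∧ (A2) ∧ (A3) ∧ (A4) ∧ (A5)` body of
#41 :289 token for token (general `{N M n}`; #41 is its curve-frame instance `Fin 2 × Fin 1`), so the typist's tie is `exact … (this theorem) …` after feeding the organs.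
Sources: [MoeglinWaldspurger1995, II.1.5, IV.1.8–IV.1.11]; [Tan1999, §1, §4 Prop. 4.8]; [Liu2021, Lem. B.10 (2), B.12].
HONEST LABEL.  Helper lemmas, count-neutral; `HC_CM` is proved only modulo the 7 printed citations (2 remaining named inputs:
hLiu418 = `stmt-HodgeConjecture-24832`, h413 = `stmt-HodgeConjecture-24833`) until rung 0 closes.
-/

set_option autoImplicit false
set_option linter.dupNamespace false -- the mandated namespace repeats `HodgeConjecture.HodgeConjecture`

noncomputable section

namespace Summit.HodgeConjecture.HodgeConjecture.Cruxes.HLiu418.K2LiuSiegelEisensteinAssembly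

open Set Filter Topology Metric Complex
open scoped BigOperators MatrixGroups
open NumberField IsDedekindDomain
open Literature.NumberTheory.Automorphic Literature.NumberTheory.GaloisRepresentations
open Literature.NumberTheory.GelbartRogawski1991 Literature.NumberTheory.GelbartRogawski1991.GRConstruction
open Literature.NumberTheory.K2Lit.SiegelDoubled
open K2LiuSiegelEisensteinAssemblyCore K2LiuSiegelEisensteinDoubledLeftInvariant

variable (L : Type) [Field L] [NumberField L] [IsCMField L] {N M n : ℕ} (e : Fin N × Fin M ≃ Fin n)
  (dV : Fin N → L) (hdV : ∀ i, IsCMField.complexConj L (dV i) = dV i)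
  (dW : Fin M → L) (hdW : ∀ i, IsCMField.complexConj L (dW i) = dW i)

/-- **Φ9 — THE ASSEMBLY OF #41 FROM TERM PACKAGES.**  For a Hecke character `χ`, a family of Siegel sections `f` (`hf`), a finite `P ⊂ ℂ` and TERM PACKAGES
`Ec : ι → ℂ → H(𝔸) → ℂ` — each holomorphic in `s` on `{0 < re}` (`hd`), continuous in `h` (`hc`), summing to `(∏_{p∈P}(s−p))·E^Δ(h; f_s)` on `{n∕2 < re}` (`heq`),
with ONE locally uniform summable majorant (`hmaj`) and summed growth `Σ'_i ‖Ec i s h‖ ≤ C·‖h‖^A` locally uniformly in `s` (`hgrowth`) — the family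
`Es s h := Σ'_i Ec i s h` is a CONTINUATION PACKAGE of `E^Δ(·; f_s)` on `{0 < re}` in the exact sense of socket #41: holomorphic in `s`, continuous and left
`H(L⁺)`-invariant in `h`, `= (∏(s−p))·E^Δ` on `{n∕2 < re}`, of locally uniform moderate growth in `adelicHeightGL`.
[cite: MoeglinWaldspurger1995, IV.1.8–IV.1.11] [cite: Tan1999, §1; §4 Prop. 4.8] [cite: Liu2021, Lem. B.10 (2) p. 102] -/
theorem exists_continuation_package_of_term_packages (χ : HeckeCharacter L) (f : ℂ → HA L e dV hdV dW hdW → ℂ)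
    (hf : ∀ s : ℂ, IsSiegelDeltaSection L e dV hdV dW hdW χ s (f s)) (P : Finset ℂ) {ι : Type*} (Ec : ι → ℂ → HA L e dV hdV dW hdW → ℂ)
    (hd : ∀ i (h : HA L e dV hdV dW hdW), DifferentiableOn ℂ (fun s => Ec i s h) {s : ℂ | 0 < s.re})
    (hc : ∀ i (s : ℂ), 0 < s.re → Continuous (Ec i s))
    (heq : ∀ (s : ℂ) (h : HA L e dV hdV dW hdW), (n : ℝ) / 2 < s.re →
      HasSum (fun i => Ec i s h) ((∏ p ∈ P, (s - p)) * eisensteinFamilyDelta L e dV hdV dW hdW f s h))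
    (hmaj : ∀ z : ℂ, 0 < z.re → ∀ h₀ : HA L e dV hdV dW hdW, ∃ r > (0 : ℝ), ∃ V ∈ 𝓝 h₀, ∃ m : ι → ℝ, Summable m ∧
      ∀ s : ℂ, dist s z < r → ∀ h ∈ V, ∀ i, ‖Ec i s h‖ ≤ m i)
    (hgrowth : ∀ z : ℂ, 0 < z.re → ∃ C A r : ℝ, 0 < r ∧ ∀ s : ℂ, dist s z < r → ∀ h : HA L e dV hdV dW hdW,
      ∑' i, ‖Ec i s h‖ ≤ C * adelicHeightGL (n + n) L (h : GL (Fin (n + n)) (AdeleRing (𝓞 L) L)) ^ A) :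
    ∃ (P' : Finset ℂ) (Es : ℂ → HA L e dV hdV dW hdW → ℂ),
      (∀ h : HA L e dV hdV dW hdW, DifferentiableOn ℂ (fun s => Es s h) {s : ℂ | 0 < s.re}) ∧
      (∀ s : ℂ, 0 < s.re → Continuous (Es s)) ∧
      (∀ s : ℂ, 0 < s.re → ∀ (γ : ratH L e dV hdV dW hdW) (h : HA L e dV hdV dW hdW),
        Es s ((γ : HA L e dV hdV dW hdW) * h) = Es s h) ∧
      (∀ (s : ℂ) (h : HA L e dV hdV dW hdW), (n : ℝ) / 2 < s.re →
        Es s h = (∏ p ∈ P', (s - p)) * eisensteinFamilyDelta L e dV hdV dW hdW f s h) ∧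
      (∀ z : ℂ, 0 < z.re → ∃ C A r : ℝ, 0 < r ∧ ∀ s : ℂ, dist s z < r → ∀ h : HA L e dV hdV dW hdW,
        ‖Es s h‖ ≤ C * adelicHeightGL (n + n) L (h : GL (Fin (n + n)) (AdeleRing (𝓞 L) L)) ^ A) := by
  -- (A3) input on the convergence half-plane: ★ #10b
  have hE : ∀ (γ : ratH L e dV hdV dW hdW) (s : ℂ) (h : HA L e dV hdV dW hdW), (n : ℝ) / 2 < s.re →
      eisensteinFamilyDelta L e dV hdV dW hdW f s ((γ : HA L e dV hdV dW hdW) * h) = eisensteinFamilyDelta L e dV hdV dW hdW f s h :=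
    fun γ s h _ => siegelEisensteinDoubledLeftInvariant L e dV hdV dW hdW χ s (f s) (hf s) γ h
  obtain ⟨Es, h1, h2, h3, h4, h5⟩ := exists_package_of_term_packages (0 : ℝ) ((n : ℝ) / 2) (eisensteinFamilyDelta L e dV hdV dW hdW f) P Ec
    hd hc heq hmaj (fun h : HA L e dV hdV dW hdW => adelicHeightGL (n + n) L (h : GL (Fin (n + n)) (AdeleRing (𝓞 L) L))) hgrowth
    (fun (γ : ratH L e dV hdV dW hdW) (h : HA L e dV hdV dW hdW) => (γ : HA L e dV hdV dW hdW) * h) hE (by positivity)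
  exact ⟨P, Es, h1, h2, h3, h4, h5⟩

end Summit.HodgeConjecture.HodgeConjecture.Cruxes.HLiu418.K2LiuSiegelEisensteinAssembly

end
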